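import Summits.BirchSwinnertonDyer.BirchSwinnertonDyer.Theses.UniversalToricDescent
import Literature.NumberTheory.EllipticCurves.Castella2024.LambdaAdicHeegnerClassExistence
import Literature.NumberTheory.EllipticCurves.HeegnerModuleIndex
import Literature.NumberTheory.EllipticCurves.BurungaleKobayashiNakamuraOta2026.LocalBottomIndex
import Literature.NumberTheory.EllipticCurves.GreenbergSelmer
import Literature.NumberTheory.EllipticCurves.AnticyclotomicSignedHeegnerClasses

/-!
# Sketch (utd-idea g61): the BOTTOM LAYER of K1 = (β) on bucket B of `TwinAlgMuZeroAtThree`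

Crux `Summit.BirchSwinnertonDyer.BirchSwinnertonDyer.Theses.UniversalToricDescent.TwinAlgMuZeroAtThree`
(stmt-BirchSwinnertonDyer-24737), line `beta-road` v5 (LEAD utd-p1 g23), stub `stub_coherentBetaMult` (K1).

Typed candidates of the lens memo LENS-MEMO-UTD-IDEA-v61 (crux idea card `bottom-layer-ell-invariant-test`):

* `kummer_ne_zero_of_zsmul_coprime` — PROVED: local `m`-indivisibility transfers from `y` to `c • y` for `c` prime
  to `m` (Bezout on Kummer classes; uses the tree's `kummerClassOver_eq_zero_iff` / `_eq_zero_of_fixed`).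
* `BottomBetaNonsplit` — PROVED (`bottomBetaNonsplit_holds`): for a family with bottom relation `F.z 0 = c • F.y`,
  `c` prime to `3` (Bertolini–Darmon 1996 §2.5 (8) on the NONSPLIT half B⁻: `z_0 = (a₃ − 1)•y_K = −2•y_K`, `u = 1`),
  local `3`-indivisibility of the basic Heegner point `y_K` at `𝔭` gives K1's layer conclusion at `k = 0`;
  `k1_of_bottom` packages it in `stub_coherentBetaMult`'s exact `∃ jbar F α, … ∃ k, …` shape (`k = 0`).
* `BDBottomFamily` — candidate PRINT-PORT fact (Prop only): existence of a Bertolini–Darmon-compatible family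
  with Manin constant prime to `3`, exact sign `α = a₃(E′)`, and the bottom relation `F.z 0 = ±(a₃ − 1) • F.y`
  (BD96 §2.4–2.5 (7)–(8), Prop. 2.7; LEAD research map A1–A3); `k1_nonsplit_of_bdBottomFamily` — PROVED:
  `BDBottomFamily` + `a₃(E′) = −1` + [`y_K ∉ 3·E′(K_𝔭)` for the families' `y_K`] ⟹ K1 verbatim.
* `BottomBetaSplitConditional` — candidate CONJECTURAL shortcut (Prop only) on the SPLIT half B⁺ (`a₃ = +1`,
  exceptional zero `F.z 0 = 0`): if the decomposition group of `𝔭` fills `Γ` and `y_K ∉ 3·E′(K_𝔭)`, then some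
  layer point is locally `3`-indivisible (memo §3: `lim← E′(K_{k,𝔭}) ⊗ ℤ₃ ≅ Λ` by local CFT + Nakayama; bottom
  defect `δ₀ = v₃(log^{ac,prim}_𝔭(q_{E′}))` of the universal norms; Castella 2024 Thm 2.1 `pr_0 𝐳′ = 𝓛_𝔭(f,K)·κ_f`
  (Molina / Disegni) ported to `p = 3`; ASSUMPTION A𝓛: `v₃ 𝓛_𝔭(f,K) = δ₀`, i.e. `𝓛_𝔭(f,K) ∈ ℤ₃^× · log^{ac}_γ(q)/ord₃ q`
  — then `v₃ f′(0) = ι_𝔭(y_K)` for `loc_𝔭 𝐳′ = f′·g`, and `ι_𝔭(y_K) = 0 ⟹ μ(f′) = 0 ⟺ K1`).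

The "`T^{3ⁿ−3^k}` lemma" of beta-road v5 is NOT restated here: it LANDED as
`Theorems/UniversalToricDescentResidualNormSpan.lean` (`sum_pow_one_add_X_eq_X_pow`, p737965, LEAD utd-p1 g23).

No `sorry`. Nothing here is a route item; BSD is proved for no curve by this file.
-/

noncomputable section

open scoped Classical

set_option linter.dupNamespace false
set_option autoImplicit false

namespace Summit.BirchSwinnertonDyer.BirchSwinnertonDyer.Cruxes.TwinAlgMuZeroAtThree.BottomLayer

open NumberField IsDedekindDomain Field WeierstrassCurve Polynomial
open Literature.NumberTheory.EllipticCurves Literature.NumberTheory.EllipticCurves.GreenbergSelmer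

/-! ## 1. Transfer of local indivisibility along a unit multiple (PROVED) -/

/-- **Local `m`-indivisibility transfers along multiples prime to `m`.** Over any field, for a subgroup
`H'` of the absolute Galois group, an `H'`-fixed point `y` and `z = c • y` with `c` coprime to `m`: if every
`m`-th root of `y` has non-zero Kummer class over `H'` (i.e. `y ∉ m • E(F̄)^{H'}`), then so does every `m`-th root
of `z`. Proof: if `m • R = z` with `R` fixed, Bezout `a c + b m = 1` gives `y = m • (a • R + b • y)` with a FIXED
root, whose Kummer class vanishes. [folklore; Silverman AEC VIII §2] -/
theorem kummer_ne_zero_of_zsmul_coprime {F : Type} [Field F] (V : WeierstrassCurve F)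
    (H' : Subgroup (absoluteGaloisGroup F)) (m c : ℤ) (hc : IsCoprime c m)
    (y z : geomPoints V) (hyfix : ∀ σ ∈ H', σ • y = y) (hz : z = c • y)
    (hy : ∀ (Q : geomPoints V) (hQ : ∀ σ ∈ H', σ • (m • Q) = m • Q), m • Q = y →
      V.kummerClassOver H' m Q hQ ≠ 0) :
    ∀ (Q : geomPoints V) (hQ : ∀ σ ∈ H', σ • (m • Q) = m • Q), m • Q = z →
      V.kummerClassOver H' m Q hQ ≠ 0 := by
  intro Q hQ hmQ habs
  obtain ⟨R, hRfix, hR⟩ := (V.kummerClassOver_eq_zero_iff H' m Q hQ).1 habs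
  obtain ⟨a, b, hab⟩ := hc
  -- the fixed root of `y`
  set R' : geomPoints V := a • R + b • y with hR'
  have hR'fix : ∀ σ ∈ H', σ • R' = R' := fun σ hσ ↦ by
    rw [hR', smul_add, smul_zsmul_geomPoints, smul_zsmul_geomPoints, hRfix σ hσ, hyfix σ hσ]
  have hmR' : m • R' = y := by
    rw [hR', zsmul_add, smul_smul, smul_smul, mul_comm m a, ← smul_smul, hR, hmQ, hz, smul_smul,
      ← add_smul, mul_comm m b, hab, one_smul]
  exact hy R' (fun σ hσ ↦ by rw [smul_zsmul_geomPoints, hR'fix σ hσ]) hmR'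
    (V.kummerClassOver_eq_zero_of_fixed H' m R' hR'fix)

/-! ## 2. The bottom relation and the B⁻ rung generator -/

/-- **Candidate print-port fact `BDBottomFamily`** (Prop only; Bertolini–Darmon 1996 §2.4 "compatible system",
§2.5 (7)–(8) and Prop. 2.7 at `p = 3 ∥ N′`, `3 = 𝔭𝔭̄` split in `K`, `u = ½#𝒪_K^× = 1` because `d_K` is odd and
`≠ −3`; Manin constant prime to `3`: Mazur 1978 / Abbes–Ullmo 1996 for the optimal curve at `3 ∥ N′` plus
`ρ̄₃` irreducible ⟹ no `3`-isogeny in the class — LEAD research map A1–A3): on bucket B there is a Heegner family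
along the anticyclotomic `ℤ₃`-tower with `3 ∤ c_φ`, norm-coherent with the EXACT sign `α = a₃(E′) ∈ {±1}`, whose
bottom norm point satisfies `z_0 = Norm_{K[3]/K} P[3] = ±(a₃ − 1) • y_K` (`= ∓2 • y_K` nonsplit, `= 0` split:
the exceptional zero, Castella 2024 Thm 2.1 first assertion — in the tree CONDITIONALLY as
`Castella2024.proj_zero_eq_zero_of_thm13_minimal_OPEN_of_split`). The sign `ε` absorbs the two print
normalisations (BD96 (8) `u·Norm y_1 = (a_p − σ) y_0` vs Castella's `u⁻¹(1 − α⁻¹)∑_τ y_1^τ`). Why it might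
fail: the tree's `IsHeegnerGeomPoint` at conductor `3` with `3 ∣ N′` admits imprimitive Heegner forms, so the
EXISTENCE must pick BD's pair-type CM points `(𝒪_{3^{n+1}} → 𝒪_{3^n})`, and `K_j ⊂ K[3^{j+1}]` (LEAD A2) is
needed for `HeegnerFamily` to be inhabited; the relation is stated after the trace to `K`, where the Frobenius
ambiguity `(a₃ − σ_𝔭)` vs `(a₃ − σ_𝔭̄)` disappears. -/
def BDBottomFamily : Prop :=
  ∀ (W' : WeierstrassCurve ℚ) [W'.IsElliptic] [W'.IsGloballyMinimal] (N' : ℕ) [NeZero N']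
    (K : Type) [Field K] [NumberField K],
    Rank1Residual.Mult W' 3 → ¬ 3 ∣ padicValInt 3 W'.minimalDiscriminantInt →
    W'.HasSurjectiveModNGaloisRep 3 → W'.conductorNorm ℤ = N' → IsImaginaryQuadratic K →
    SatisfiesHeegnerHypothesis N' K → Odd (NumberField.discr K) →
    ∀ (κ : ZpExtension K 3), κ.IsAnticyclotomic →
    ∀ (γ : absoluteGaloisGroup K) [Fact (κ.IsTopGenerator γ)],
    ∃ (jbar : AlgebraicClosure K →+* ℂ) (F : HeegnerFamily N' W' K κ jbar),
      ¬ (3 : ℤ) ∣ F.Dt.c ∧ F.IsNormCompatible γ (W'.frobeniusTrace 3) ∧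
      ∃ ε : ℤ, ε ^ 2 = 1 ∧ F.z 0 = (ε * (W'.frobeniusTrace 3 - 1)) • F.y

/-- **`BottomBetaNonsplit`** (the B⁻ rung generator, typed in `stub_coherentBetaMult`'s own currency): for ANY
Heegner family whose bottom norm point is a prime-to-`3` multiple of the basic Heegner point, `F.z 0 = c • F.y`
(on the NONSPLIT half of bucket B, `a₃(E′) = −1`, the Bertolini–Darmon relation gives `c = ∓2`), local
`3`-indivisibility of `y_K` at a prime `𝔭 ∣ 3` (every cube root of `y_K` has non-zero Kummer class over
`Γ_{K_0} ∩ D_𝔭 = D_𝔭`, i.e. `y_K ∉ 3·E′(K_𝔭)`) gives K1's layer conclusion AT `k = 0`. Per instance `(E′, K, 𝔭)` the hypothesis is ONE exact finite computation on `y_K ∈ E′(K)`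
(formal-group valuation at `𝔭`, `E′(ℚ₃) ⊗ ℤ₃ ≅ ℤ₃` on B⁻) — the census's QBETA engine run on the twin. -/
def BottomBetaNonsplit : Prop :=
  ∀ (W' : WeierstrassCurve ℚ) [W'.IsElliptic] [W'.IsGloballyMinimal] (N' : ℕ) [NeZero N']
    (K : Type) [Field K] [NumberField K] (κ : ZpExtension K 3)
    (𝔭 : HeightOneSpectrum (𝓞 K)) (jbar : AlgebraicClosure K →+* ℂ) (F : HeegnerFamily N' W' K κ jbar)
    (c : ℤ), IsCoprime c 3 → F.z 0 = c • F.y →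
    (∀ (Q : geomPoints (W'.baseChange K))
      (hQ : ∀ σ ∈ κ.layerSubgroup 0 ⊓ decomp 𝔭, σ • ((3 : ℤ) • Q) = (3 : ℤ) • Q),
      (3 : ℤ) • Q = F.y → (W'.baseChange K).kummerClassOver (κ.layerSubgroup 0 ⊓ decomp 𝔭) 3 Q hQ ≠ 0) →
    ∀ (Q : geomPoints (W'.baseChange K))
      (hQ : ∀ σ ∈ κ.layerSubgroup 0 ⊓ decomp 𝔭, σ • ((3 : ℤ) • Q) = (3 : ℤ) • Q),
      (3 : ℤ) • Q = F.z 0 → (W'.baseChange K).kummerClassOver (κ.layerSubgroup 0 ⊓ decomp 𝔭) 3 Q hQ ≠ 0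

/-- `BottomBetaNonsplit` HOLDS (from §1 with `c = −2`, coprime to `3`; `y_K` is `Γ_K`-fixed by
`IsHeegnerNormPoint.smul_eq_self` at layer `0`). [folklore] -/
theorem bottomBetaNonsplit_holds : BottomBetaNonsplit := by
  intro W' _ _ N' _ K _ _ κ 𝔭 jbar F c hc hz0 hy
  refine kummer_ne_zero_of_zsmul_coprime (W'.baseChange K) (κ.layerSubgroup 0 ⊓ decomp 𝔭) 3
    c hc F.y (F.z 0) (fun σ hσ ↦ ?_) hz0 hy
  exact F.isHeegnerNormPoint_y.smul_eq_self (Subgroup.mem_inf.mp hσ).1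

/-- **From the bottom test to K1's shape** (PROVED packaging): a family with `3 ∤ c_φ`, norm-coherent with a sign
`α`, whose bottom norm point is a prime-to-`3` multiple of `y_K`, and `y_K` locally `3`-indivisible at `𝔭`, give
`stub_coherentBetaMult`'s conclusion verbatim (with `k = 0`). -/
theorem k1_of_bottom (W' : WeierstrassCurve ℚ) [W'.IsElliptic] [W'.IsGloballyMinimal] (N' : ℕ)
    [NeZero N'] (K : Type) [Field K] [NumberField K] (κ : ZpExtension K 3) (γ : absoluteGaloisGroup K)
    (𝔭 : HeightOneSpectrum (𝓞 K)) (jbar : AlgebraicClosure K →+* ℂ) (F : HeegnerFamily N' W' K κ jbar)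
    (α : ℤ) (hα : α ^ 2 = 1) (hcφ : ¬ (3 : ℤ) ∣ F.Dt.c) (hcoh : F.IsNormCompatible γ α)
    (c : ℤ) (hc : IsCoprime c 3) (hz0 : F.z 0 = c • F.y)
    (hy : ∀ (Q : geomPoints (W'.baseChange K))
      (hQ : ∀ σ ∈ κ.layerSubgroup 0 ⊓ decomp 𝔭, σ • ((3 : ℤ) • Q) = (3 : ℤ) • Q),
      (3 : ℤ) • Q = F.y → (W'.baseChange K).kummerClassOver (κ.layerSubgroup 0 ⊓ decomp 𝔭) 3 Q hQ ≠ 0) :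
    ∃ (jbar : AlgebraicClosure K →+* ℂ) (F : HeegnerFamily N' W' K κ jbar) (α : ℤ),
      ¬ (3 : ℤ) ∣ F.Dt.c ∧ α ^ 2 = 1 ∧ F.IsNormCompatible γ α ∧
      (∃ k : ℕ, ∀ (Q : geomPoints (W'.baseChange K))
        (hQ : ∀ σ ∈ κ.layerSubgroup k ⊓ decomp 𝔭, σ • ((3 : ℤ) • Q) = (3 : ℤ) • Q),
        (3 : ℤ) • Q = F.z k →
          (W'.baseChange K).kummerClassOver (κ.layerSubgroup k ⊓ decomp 𝔭) 3 Q hQ ≠ 0) :=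
  ⟨jbar, F, α, hcφ, hα, hcoh, 0, bottomBetaNonsplit_holds W' N' K κ 𝔭 jbar F c hc hz0 hy⟩

/-- **K1 on the nonsplit half B⁻ from the port + one bit** (PROVED): `BDBottomFamily`, `a₃(E′) = −1`, and local
`3`-indivisibility at `𝔭` of the basic Heegner point of the families (all share `y_K = Tr_{K[1]/K} P[1]` up to
the orientation / sign ambiguity, which does not change `3`-divisibility in `E′(K_𝔭) ⊗ ℤ₃ ≅ ℤ₃`) give
`stub_coherentBetaMult` (K1) for `(E′, K, κ, γ, 𝔭)` — the hypotheses below are K1's, verbatim. -/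
theorem k1_nonsplit_of_bdBottomFamily (hBD : BDBottomFamily) :
    ∀ (W' : WeierstrassCurve ℚ) [W'.IsElliptic] [W'.IsGloballyMinimal] (N' : ℕ) [NeZero N']
    (K : Type) [Field K] [NumberField K],
    Rank1Residual.Mult W' 3 → ¬ 3 ∣ padicValInt 3 W'.minimalDiscriminantInt →
    W'.HasSurjectiveModNGaloisRep 3 → W'.conductorNorm ℤ = N' → IsImaginaryQuadratic K →
    SatisfiesHeegnerHypothesis N' K → Odd (NumberField.discr K) →
    ∀ (κ : ZpExtension K 3), κ.IsAnticyclotomic →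
    ∀ (γ : absoluteGaloisGroup K) [Fact (κ.IsTopGenerator γ)] (𝔭 : HeightOneSpectrum (𝓞 K)),
    ((3 : ℕ) : 𝓞 K) ∈ 𝔭.asIdeal → 𝔭.asIdeal.ramificationIdx (𝓞 ℚ) = 1 → 𝔭.asIdeal.inertiaDeg (𝓞 ℚ) = 1 →
    W'.frobeniusTrace 3 = -1 →
    (∀ (jbar : AlgebraicClosure K →+* ℂ) (F : HeegnerFamily N' W' K κ jbar) (Q : geomPoints (W'.baseChange K))
      (hQ : ∀ σ ∈ κ.layerSubgroup 0 ⊓ decomp 𝔭, σ • ((3 : ℤ) • Q) = (3 : ℤ) • Q),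
      (3 : ℤ) • Q = F.y → (W'.baseChange K).kummerClassOver (κ.layerSubgroup 0 ⊓ decomp 𝔭) 3 Q hQ ≠ 0) →
    ∃ (jbar : AlgebraicClosure K →+* ℂ) (F : HeegnerFamily N' W' K κ jbar) (α : ℤ),
      ¬ (3 : ℤ) ∣ F.Dt.c ∧ α ^ 2 = 1 ∧ F.IsNormCompatible γ α ∧
      (∃ k : ℕ, ∀ (Q : geomPoints (W'.baseChange K))
        (hQ : ∀ σ ∈ κ.layerSubgroup k ⊓ decomp 𝔭, σ • ((3 : ℤ) • Q) = (3 : ℤ) • Q),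
        (3 : ℤ) • Q = F.z k →
          (W'.baseChange K).kummerClassOver (κ.layerSubgroup k ⊓ decomp 𝔭) 3 Q hQ ≠ 0) := by
  intro W' _ _ N' _ K _ _ hm hv hs hN hK hH hd κ hκ γ _ 𝔭 _ _ _ ha3 hy
  obtain ⟨jbar, F, hcφ, hcoh, ε, hε, hz0⟩ := hBD W' N' K hm hv hs hN hK hH hd κ hκ γ
  have hε' : ε = 1 ∨ ε = -1 := sq_eq_one_iff.mp hε
  have hc : IsCoprime (ε * (W'.frobeniusTrace 3 - 1)) 3 := by
    rw [ha3]; rcases hε' with h | h <;> subst h <;> norm_num [Int.isCoprime_iff_gcd_eq_one]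
  exact k1_of_bottom W' N' K κ γ 𝔭 jbar F (W'.frobeniusTrace 3) (by rw [ha3]; norm_num) hcφ hcoh
    (ε * (W'.frobeniusTrace 3 - 1)) hc hz0 (hy jbar F)

/-! ## 3. The split half B⁺: the conditional bottom shortcut (candidate, Prop only) -/

/-- **`BottomBetaSplitConditional`** (CONJECTURAL candidate at `p = 3`; beyond print): on the SPLIT half B⁺
(`a₃(E′) = +1`; exceptional zero `z_0 = 0`, `𝐳_∞ = (γ − 1)𝐳′_∞`), if the decomposition group of `𝔭` fills
`Γ = Gal(K_∞/K)` (`Γ_{K_1}·D_𝔭 = Γ_K`; automatic when `3 ∤ h_K`) and the basic Heegner point `y_K` is locally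
`3`-indivisible at `𝔭`, then for every BD-type family (`3 ∤ c_φ`, coherent with `α = 1`, `z_0 = 0`) SOME layer
point `z_k` is locally `3`-indivisible at `𝔭`. Mechanism (memo §3): (i) `𝕌 := lim← E′(K_{k,𝔭}) ⊗ ℤ₃ ≅
H¹_Iw(ℚ₃, ℤ₃(1)) ≅ Λ` (Tate curve; `q` is not a universal norm since `log^{ac}_𝔭(q) ≠ 0` by the transcendence of
`q` [Barré-Sirieix–Diaz–Gramain–Philibert 1996]; `𝕌_Γ ≅` universal norms `≅ ℤ₃` + Nakayama + rank one);
(ii) `pr_0(𝕌) = 3^{δ₀}·(E′(ℚ₃) ⊗ ℤ₃)`, `δ₀ = v₃(log^{ac,prim}_𝔭(q_{E′}))` (local CFT; `3 ∤ ord₃ q` on bucket B);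
(iii) Castella 2024 Thm 2.1 (second assertion, via Molina TAMS 372 Thm 7.5 = arXiv:1509.08617 §6–7, Disegni
Thm 4.2.5.4): `pr_0 𝐳′_∞ = 𝓛_𝔭(f,K)·κ_f`, `κ_f = δ(y_K)`; (iv) ASSUMPTION A𝓛: `𝓛_𝔭(f,K) ∈ ℤ₃^×·log^{ac}_γ(q)/ord₃ q`
(geometric = automorphic anticyclotomic `𝓛`-invariant up to a `3`-adic unit), whence `v₃ 𝓛_𝔭(f,K) = δ₀` and, for
`loc_𝔭 𝐳′ = f′·g`, `v₃ f′(0) = ι_𝔭(y_K)`; (v) K1 `⟺ (γ−1)f′ ∉ 3Λ ⟺ μ(f′) = 0 ⟸ f′(0) ∈ ℤ₃^× ⟺ ι_𝔭(y_K) = 0`.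
Unconditional consequence of (i)–(iii) alone: `v₃ 𝓛_𝔭(f,K) + ι_𝔭(y_K) ≥ δ₀`. Cheapest falsifier: a B⁺ habitat
with `3 ∤ h_K`, `y_K ∉ 3E′(K_𝔭)` and `z_1, z_2 ∈ 3E′(K_{k,𝔭})` with `δ₀ = 0` (then layer `1` must already witness). -/
def BottomBetaSplitConditional : Prop :=
  ∀ (W' : WeierstrassCurve ℚ) [W'.IsElliptic] [W'.IsGloballyMinimal] (N' : ℕ) [NeZero N']
    (K : Type) [Field K] [NumberField K],
    Rank1Residual.Mult W' 3 → ¬ 3 ∣ padicValInt 3 W'.minimalDiscriminantInt →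
    W'.HasSurjectiveModNGaloisRep 3 → W'.conductorNorm ℤ = N' → IsImaginaryQuadratic K →
    SatisfiesHeegnerHypothesis N' K → Odd (NumberField.discr K) →
    ∀ (κ : ZpExtension K 3), κ.IsAnticyclotomic →
    ∀ (γ : absoluteGaloisGroup K) [Fact (κ.IsTopGenerator γ)]
      (𝔭 : HeightOneSpectrum (𝓞 K)), ((3 : ℕ) : 𝓞 K) ∈ 𝔭.asIdeal →
      𝔭.asIdeal.ramificationIdx (𝓞 ℚ) = 1 → 𝔭.asIdeal.inertiaDeg (𝓞 ℚ) = 1 →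
      κ.layerSubgroup 1 ⊔ decomp 𝔭 = ⊤ →
    W'.frobeniusTrace 3 = 1 →
    ∀ (jbar : AlgebraicClosure K →+* ℂ) (F : HeegnerFamily N' W' K κ jbar),
      ¬ (3 : ℤ) ∣ F.Dt.c → F.IsNormCompatible γ 1 → F.z 0 = 0 →
      (∀ (Q : geomPoints (W'.baseChange K))
        (hQ : ∀ σ ∈ κ.layerSubgroup 0 ⊓ decomp 𝔭, σ • ((3 : ℤ) • Q) = (3 : ℤ) • Q),
        (3 : ℤ) • Q = F.y →
          (W'.baseChange K).kummerClassOver (κ.layerSubgroup 0 ⊓ decomp 𝔭) 3 Q hQ ≠ 0) →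
      ∃ k : ℕ, ∀ (Q : geomPoints (W'.baseChange K))
        (hQ : ∀ σ ∈ κ.layerSubgroup k ⊓ decomp 𝔭, σ • ((3 : ℤ) • Q) = (3 : ℤ) • Q),
        (3 : ℤ) • Q = F.z k →
          (W'.baseChange K).kummerClassOver (κ.layerSubgroup k ⊓ decomp 𝔭) 3 Q hQ ≠ 0

/-! ## §5. Bucket C₀ (`3 ∤ N′`, good supersingular, `a₃(E′) = 0`; 603 classes): the SAME bottom bit

At a prime `p ∤ N′` split in `K` the bottom relation of the Heegner system is
`u · Norm_{K[p]/K[1]} y_1 = (a_p − σ_{𝔭₁} − σ_{𝔭₂}) · y_0` (Bertolini–Darmon, Invent. 126 (1996) §2.5 eq. (6), p. 434, the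
`(p) = 1` case; Perrin-Riou 1987), whence in the tree's indexing
`z 0 = Norm_{K[p]/K} P[p] = (a_p − 2) · y_K` (`u = 1`: `d_K` odd, `K ≠ ℚ(√−3)` since `3` splits).
On C₀, `a₃ = 0`, so `z 0 = −2 · y_K` — a prime-to-`3` multiple exactly as on B⁻ — and `bottomBetaNonsplit_holds`
(generic in `c`) decides g51/g57's K1 body AT LAYER `0` (= `LayerIndivisibleAt W′ K κ jbar F 𝔭 0` of
`Cruxes/TwinAlgMuZeroAtThree/SketchHeightTwoNewtonSignedBetaG57.lean`, hence `LocalIndivisibleLayer`, g51's K1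
verbatim, with witness `k = 0`; and layer `0` has parity `ε = +1` for the signed frame) by the bit `ι_𝔭(y_K) = 0`.
No exceptional zero occurs on C₀ (`a₃ − 2 = −2`); the general good split prime has `c = a_p − 2`, which is a unit
at `p` iff `a_p ≢ 2 (mod p)` — automatic for `a₃ = 0`. -/

/-- CANDIDATE `Prop` (port, bucket C₀): there is a TRACE-COHERENT (`a₃ = 0`: `Tr z_{n+2} = −z_n`, tree predicate
`HeegnerFamily.IsTraceCoherentApZero`) Heegner family with Manin constant prime to `3` whose bottom norm point
satisfies the `p ∤ N′` bottom relation `z 0 = (a₃ − 2) • y_K`. Why it might fail: only the inhabitedness of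
`HeegnerFamily` on C₀ (`K_j ⊂ K[3^{j+1}]`, LEAD A2) and the choice of a compatible system of CM points of
`3`-power conductor — the relation itself is the printed Euler-system relation traced to `K`. -/
def PRBottomFamilyGood : Prop :=
  ∀ (W' : WeierstrassCurve ℚ) [W'.IsElliptic] [W'.IsGloballyMinimal] (N' : ℕ) [NeZero N']
    (K : Type) [Field K] [NumberField K],
    Rank1Residual.GoodSS W' 3 → W'.frobeniusTrace 3 = 0 →
    W'.HasSurjectiveModNGaloisRep 3 → W'.conductorNorm ℤ = N' → IsImaginaryQuadratic K →
    SatisfiesHeegnerHypothesis N' K → Odd (NumberField.discr K) →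
    ∀ (κ : ZpExtension K 3), κ.IsAnticyclotomic →
    ∃ (jbar : AlgebraicClosure K →+* ℂ) (F : HeegnerFamily N' W' K κ jbar),
      ¬ (3 : ℤ) ∣ F.Dt.c ∧ F.IsTraceCoherentApZero ∧ F.z 0 = (W'.frobeniusTrace 3 - 2) • F.y

/-- **Layer-`0` indivisibility on C₀ from the port + one bit** (PROVED packaging): a family with the `p ∤ N′`
bottom relation and `a₃ = 0`, plus `y_K ∉ 3·E′(K_𝔭)` (non-zero Kummer class of every cube root of `y_K` over
`D_𝔭`), gives g51's K1 body at layer `0` (`LayerIndivisibleAt … F 𝔭 0`), stated here by its body. -/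
theorem layerZero_indivisible_of_goodSS_bottom (W' : WeierstrassCurve ℚ) [W'.IsElliptic]
    [W'.IsGloballyMinimal] (N' : ℕ) [NeZero N'] (K : Type) [Field K] [NumberField K]
    (κ : ZpExtension K 3) (𝔭 : HeightOneSpectrum (𝓞 K)) (jbar : AlgebraicClosure K →+* ℂ)
    (F : HeegnerFamily N' W' K κ jbar) (ha : W'.frobeniusTrace 3 = 0)
    (hz0 : F.z 0 = (W'.frobeniusTrace 3 - 2) • F.y)
    (hy : ∀ (Q : geomPoints (W'.baseChange K))
      (hQ : ∀ σ ∈ κ.layerSubgroup 0 ⊓ decomp 𝔭, σ • ((3 : ℤ) • Q) = (3 : ℤ) • Q),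
      (3 : ℤ) • Q = F.y → (W'.baseChange K).kummerClassOver (κ.layerSubgroup 0 ⊓ decomp 𝔭) 3 Q hQ ≠ 0) :
    ∀ (Q : geomPoints (W'.baseChange K))
      (hQ : ∀ σ ∈ κ.layerSubgroup 0 ⊓ decomp 𝔭, σ • ((3 : ℤ) • Q) = (3 : ℤ) • Q),
      (3 : ℤ) • Q = F.z 0 → (W'.baseChange K).kummerClassOver (κ.layerSubgroup 0 ⊓ decomp 𝔭) 3 Q hQ ≠ 0 := by
  rw [ha] at hz0
  have hc : IsCoprime (0 - 2 : ℤ) 3 := by norm_num [Int.isCoprime_iff_gcd_eq_one]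
  exact bottomBetaNonsplit_holds W' N' K κ 𝔭 jbar F (0 - 2) hc hz0 hy

/-- **C₀ bottom rung** (PROVED modulo the port `PRBottomFamilyGood`): on bucket C₀, if the basic Heegner point is
locally `3`-indivisible at `𝔭` for the port's family, that family is trace-coherent with `3 ∤ c_φ` and has a
layer (`k = 0`, parity `+1`) locally `3`-indivisible at `𝔭` — g51's K1 (`LocalIndivisibleLayer`) on C₀ with an
explicit witness layer, the input g57's engine needs at its FIRST even layer. -/
theorem k1_goodSS_layerZero_of_prBottomFamily (hPR : PRBottomFamilyGood) :
    ∀ (W' : WeierstrassCurve ℚ) [W'.IsElliptic] [W'.IsGloballyMinimal] (N' : ℕ) [NeZero N']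
    (K : Type) [Field K] [NumberField K],
    Rank1Residual.GoodSS W' 3 → W'.frobeniusTrace 3 = 0 →
    W'.HasSurjectiveModNGaloisRep 3 → W'.conductorNorm ℤ = N' → IsImaginaryQuadratic K →
    SatisfiesHeegnerHypothesis N' K → Odd (NumberField.discr K) →
    ∀ (κ : ZpExtension K 3), κ.IsAnticyclotomic →
    ∀ (𝔭 : HeightOneSpectrum (𝓞 K)),
    (∀ (jbar : AlgebraicClosure K →+* ℂ) (F : HeegnerFamily N' W' K κ jbar) (Q : geomPoints (W'.baseChange K))
      (hQ : ∀ σ ∈ κ.layerSubgroup 0 ⊓ decomp 𝔭, σ • ((3 : ℤ) • Q) = (3 : ℤ) • Q),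
      (3 : ℤ) • Q = F.y → (W'.baseChange K).kummerClassOver (κ.layerSubgroup 0 ⊓ decomp 𝔭) 3 Q hQ ≠ 0) →
    ∃ (jbar : AlgebraicClosure K →+* ℂ) (F : HeegnerFamily N' W' K κ jbar),
      ¬ (3 : ℤ) ∣ F.Dt.c ∧ F.IsTraceCoherentApZero ∧
      ∃ k : ℕ, (-1 : ℤˣ) ^ k = 1 ∧ ∀ (Q : geomPoints (W'.baseChange K))
        (hQ : ∀ σ ∈ κ.layerSubgroup k ⊓ decomp 𝔭, σ • ((3 : ℤ) • Q) = (3 : ℤ) • Q),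
        (3 : ℤ) • Q = F.z k →
          (W'.baseChange K).kummerClassOver (κ.layerSubgroup k ⊓ decomp 𝔭) 3 Q hQ ≠ 0 := by
  intro W' _ _ N' _ K _ _ hss ha hsurj hN hK hH hodd κ hκ 𝔭 hy
  obtain ⟨jbar, F, hc, hcoh, hz0⟩ := hPR W' N' K hss ha hsurj hN hK hH hodd κ hκ
  exact ⟨jbar, F, hc, hcoh, 0, by simp,
    layerZero_indivisible_of_goodSS_bottom W' N' K κ 𝔭 jbar F ha hz0 (hy jbar F)⟩

end Summit.BirchSwinnertonDyer.BirchSwinnertonDyer.Cruxes.TwinAlgMuZeroAtThree.BottomLayer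

end
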